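import Mathlib

/-!
# Király–Lütkebohmert: invariants of a regular local ring under an automorphism of prime order

F. Király, W. Lütkebohmert, *Group actions of prime order on local normal rings*,
Algebra & Number Theory **7** (2013), no. 1, 63–74, doi:10.2140/ant.2013.7.63 (arXiv:1001.1945,
"Invariants of normal local rings by p-cyclic group actions").

What is reproduced: the STATEMENT of Theorem 2 of loc. cit., restricted to a regular local ring `B`
carrying a ring automorphism `σ` of prime order `p` (no assumption on the characteristic):
if the *augmentation ideal* `I_G = (σ b - b : b ∈ B)·B` is principal, then `B` is a free module over the
ring of invariants `A = B^σ` (implications (a) ⟹ (b) ⟹ (c) of Theorem 2, valid for normal local `B`)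
and `A` is a regular local ring ((c) ⟹ (d), for regular `B`, by faithfully flat descent).
Loc. cit. also proves (a) ⟺ "`σ` acts as a pseudo-reflection" when the residue fields of `A` and `B`
coincide, and states the converse (d) ⟹ (a) as Conjecture 10.

Filed as a NAMED FACT (an unproved-here published theorem, to be used as a hypothesis). Geometric
reading used on the resolution side: a quotient of a regular variety by `ℤ/p` is regular at the image of
every point where the ideal sheaf of the fixed-point scheme is invertible.
-/

namespace Literature.AlgebraicGeometry.Resolution

universe u

variable {B : Type u} [CommRing B]

/-- The augmentation ideal (ideal of the fixed-point scheme) of a ring automorphism `σ` of `B`: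
the ideal generated by all `σ b - b`. [cite: KiralyLutkebohmert2013, Introduction (augmentation ideal `I_G`)] -/
def augmentationIdeal (σ : B ≃+* B) : Ideal B :=
  Ideal.span (Set.range fun b : B => σ b - b)

/-- The subring `B^σ` of `σ`-invariant elements (the ring of invariants `A`).
[cite: KiralyLutkebohmert2013, Introduction (ring of invariants `A = B^G`)] -/
def invariantSubring (σ : B ≃+* B) : Subring B :=
  RingHom.eqLocus (σ : B →+* B) (RingHom.id B)

/-- Membership in the ring of invariants is `σ b = b`. [folklore] -/
lemma mem_invariantSubring_iff (σ : B ≃+* B) (b : B) :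
    b ∈ invariantSubring σ ↔ σ b = b := Iff.rfl

/-- Each `σ b - b` lies in the augmentation ideal. [folklore] -/
lemma sub_mem_augmentationIdeal (σ : B ≃+* B) (b : B) :
    σ b - b ∈ augmentationIdeal σ :=
  Ideal.subset_span ⟨b, rfl⟩

/-- The augmentation ideal of the identity automorphism is `⊥`. [folklore] -/
lemma augmentationIdeal_refl : augmentationIdeal (RingEquiv.refl B) = ⊥ := by
  unfold augmentationIdeal
  rw [Ideal.span_eq_bot]
  rintro x ⟨b, rfl⟩
  simp

/-- NAMED FACT [Király–Lütkebohmert 2013, Theorem 2, (a) ⟹ (c) ⟹ (d)]: let `B` be a regular local ring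
and `σ` a ring automorphism of `B` of prime order `p` (`σ^p = 1`, `σ ≠ 1`). If the augmentation ideal
of `σ` is principal, then the ring of invariants `B^σ` is a regular local ring and `B` is a free
`B^σ`-module (of rank `p`). [cite: KiralyLutkebohmert2013, Thm. 2 ((a) ⟹ (b) ⟹ (c) ⟹ (d)), pp. 63–64] -/
def KiralyLutkebohmertRegularity : Prop :=
  ∀ (B : Type u) [CommRing B] [IsRegularLocalRing B] (p : ℕ) (σ : B ≃+* B),
    p.Prime → (∀ b : B, (⇑σ)^[p] b = b) → σ ≠ RingEquiv.refl B →
      (augmentationIdeal σ).IsPrincipal →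
        IsRegularLocalRing (invariantSubring σ) ∧ Module.Free (invariantSubring σ) B

end Literature.AlgebraicGeometry.Resolution
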